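import Mathlib
import Summits.KontsevichZagierPeriods.Zeta5Search.BrickHarmonicBlocks

/-!
# BrickHarmonicShift — the digit shift of the harmonic numbers at every odd prime:
`p·H_{x₀ + Xp} ≡ H_X + p·H_{x₀} (mod p²)` (cell zeta5-irr)

HONEST FRAMING: systematic search; no irrationality claim unless certified. INSTRUMENT-tier arithmetic of the ζ(5)
census cell zeta5-irr (HOME `run/shared/lean/pub/zeta5-irr/`), filed by the engine seat zi-eng (g13). WHAT THIS IS
NOT: nothing about ζ(5); elementary; 0 nats/n; rung F-Z1 NOT moved. Plumbing for the strip-sum law (V) of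
`BrickLucasAssembly.lucas_of_blockLaws`: the depth-one cells are harmonic differences (`BrickDepthOneCell`), and the
cross-row comparison of a cell of the row `n₀ + Np` with the cell of the one-digit row `n₀` is this congruence.

## The statements (`p` an ODD prime — `p = 3` included; `H_x = BrickHarmonicBlocks.hsum 1 x`)

* `padicValuation_blockSigma_one_le`: `v(σ₁(b)) ≤ exp(−1)`, `σ₁(b) = Σ_{0<r<p} 1/(bp+r)` (pair `r ↔ p − r`; for
  `p ≥ 5` the chain has the Wolstenholme-strength `v(p σ₁(b)) ≥ 3`, `BrickHarmonicBlocks.padicValuation_pow_mul_blockSigma_le`).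
* **`harmonic_shift`**: for `x₀ < p` and every `X`: `v(p·H_{x₀ + Xp} − H_X − p·H_{x₀}) ≤ exp(−2)`.
  (`p·H_{x₀+Xp} = H_X + p·Σ_{b<X}σ₁(b) + p·Σ_{r ≤ x₀} 1/(Xp + r)`, `BrickHarmonicBlocks.pow_mul_hsum_mul`, `hsum_add`,
  and `1/(Xp + r) ≡ 1/r (mod p)`.)
-/

namespace Summit.KontsevichZagierPeriods.Zeta5Search.BrickHarmonicShift

open Finset Nat WithZero
open Summit.KontsevichZagierPeriods.Zeta5Search.BrickHarmonicBlocks (hsum blockSigma hsum_add pow_mul_hsum_mul)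
open Literature.NumberTheory.LFunctions (padicValuation_natCast_eq_one padicValuation_natCast_le_one)

noncomputable section

variable {p : ℕ} [Fact p.Prime]

/-- A natural number strictly between two consecutive multiples of `p` is a `p`-adic unit. -/
theorem padicValuation_block_unit {b r : ℕ} (hr : 1 ≤ r) (hrp : r < p) :
    Rat.padicValuation p (((b * p + r : ℕ) : ℚ)) = 1 := by
  have hp : p.Prime := Fact.out
  refine padicValuation_natCast_eq_one fun h => ?_
  have : p ∣ r := (Nat.dvd_add_right (dvd_mul_left p b)).1 h
  exact absurd (Nat.le_of_dvd (by omega) this) (by omega)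

/-- **`v(σ₁(b)) ≤ exp(−1)` at every odd prime**: pairing `r ↔ p − r` in `σ₁(b) = Σ_{0<r<p} 1/(bp + r)` gives
`1/(bp+r) + 1/(bp+p−r) = p(2b+1)/((bp+r)(bp+p−r))`. -/
theorem padicValuation_blockSigma_one_le (hp2 : p ≠ 2) (b : ℕ) :
    Rat.padicValuation p (blockSigma p 1 b) ≤ exp (-1 : ℤ) := by
  have hp : p.Prime := Fact.out
  have hp1 : 1 ≤ p := hp.one_le
  set f : ℕ → ℚ := fun j => 1 / (((b * p + (j + 1) : ℕ) : ℚ)) with hf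
  have hσ : blockSigma p 1 b = ∑ j ∈ range (p - 1), f j := by
    rw [blockSigma, show Ico 1 p = Ico 1 (p - 1 + 1) by rw [Nat.sub_add_cancel hp1], Finset.sum_Ico_eq_sum_range,
      show p - 1 + 1 - 1 = p - 1 by omega]
    refine Finset.sum_congr rfl fun j _ => ?_
    rw [hf, pow_one, add_comm 1 j]
  -- `2σ = Σ_j (f j + f (p−2−j))`, and each pair is `p(2b+1)/(unit·unit)`
  have h2 : 2 * blockSigma p 1 b = ∑ j ∈ range (p - 1), (f j + f (p - 1 - 1 - j)) := by
    rw [hσ, two_mul, Finset.sum_add_distrib, Finset.sum_range_reflect]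
  have hpair : ∀ j ∈ range (p - 1), Rat.padicValuation p (f j + f (p - 1 - 1 - j)) ≤ exp (-1 : ℤ) := by
    intro j hj
    have hj' := mem_range.1 hj
    have hu1 : Rat.padicValuation p (((b * p + (j + 1) : ℕ) : ℚ)) = 1 := padicValuation_block_unit (by omega) (by omega)
    have hu2 : Rat.padicValuation p (((b * p + (p - 1 - 1 - j + 1) : ℕ) : ℚ)) = 1 :=
      padicValuation_block_unit (by omega) (by omega)
    have hne1 : (((b * p + (j + 1) : ℕ) : ℚ)) ≠ 0 := by positivity
    have hne2 : (((b * p + (p - 1 - 1 - j + 1) : ℕ) : ℚ)) ≠ 0 := by positivity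
    have hsum' : f j + f (p - 1 - 1 - j) =
        (p : ℚ) * (2 * b + 1) / ((((b * p + (j + 1) : ℕ) : ℚ)) * (((b * p + (p - 1 - 1 - j + 1) : ℕ) : ℚ))) := by
      rw [hf]
      simp only
      rw [div_add_div _ _ hne1 hne2, one_mul, mul_one]
      congr 1
      push_cast [show j ≤ p - 1 - 1 by omega, show 1 ≤ p - 1 by omega, hp1]
      ring
    rw [hsum', map_div₀, map_mul, map_mul, hu1, hu2, mul_one, div_one, Rat.padicValuation_self]
    calc _ ≤ exp (-1 : ℤ) * 1 := mul_le_mul' le_rfl (by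
          rw [show (2 : ℚ) * b + 1 = ((2 * b + 1 : ℕ) : ℚ) by push_cast; ring]
          exact padicValuation_natCast_le_one _)
      _ = _ := mul_one _
  have hv2 : Rat.padicValuation p (2 * blockSigma p 1 b) ≤ exp (-1 : ℤ) := by
    rw [h2]; exact Valuation.map_sum_le _ hpair
  have htwo : Rat.padicValuation p (2 : ℚ) = 1 := by
    rw [show (2 : ℚ) = ((2 : ℕ) : ℚ) by norm_num]
    exact padicValuation_natCast_eq_one fun h => hp2 ((Nat.prime_dvd_prime_iff_eq hp Nat.prime_two).1 h)
  rwa [map_mul, htwo, one_mul] at hv2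

/-- The last partial block against the one-digit harmonic number: for `r ≤ x₀ < p`,
`v(1/(Xp + r) − 1/r) ≤ exp(−1)`. -/
theorem padicValuation_inv_shift_sub_le {X r : ℕ} (hr : 1 ≤ r) (hrp : r < p) :
    Rat.padicValuation p (1 / (((X * p + r : ℕ) : ℚ)) - 1 / (r : ℚ)) ≤ exp (-1 : ℤ) := by
  have hp : p.Prime := Fact.out
  have hu1 : Rat.padicValuation p (((X * p + r : ℕ) : ℚ)) = 1 := padicValuation_block_unit hr hrp
  have hu2 : Rat.padicValuation p ((r : ℚ)) = 1 :=
    padicValuation_natCast_eq_one fun h => absurd (Nat.le_of_dvd (by omega) h) (by omega)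
  have hne1 : (((X * p + r : ℕ) : ℚ)) ≠ 0 := by positivity
  have hne2 : ((r : ℚ)) ≠ 0 := by positivity
  rw [div_sub_div _ _ hne1 hne2, one_mul, mul_one, show ((r : ℚ) - ((X * p + r : ℕ) : ℚ)) = -((p : ℚ) * X) by
    push_cast; ring, map_div₀, map_mul, hu1, hu2, mul_one, div_one, Valuation.map_neg, map_mul, Rat.padicValuation_self]
  calc _ ≤ exp (-1 : ℤ) * 1 := mul_le_mul' le_rfl (padicValuation_natCast_le_one _)
    _ = _ := mul_one _

/-- **THE DIGIT SHIFT OF THE HARMONIC NUMBERS** (odd `p`, `x₀ < p`, every `X`):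
`v(p·H_{x₀+Xp} − H_X − p·H_{x₀}) ≤ exp(−2)`, i.e. `p·H_{x₀ + Xp} ≡ H_X + p·H_{x₀} (mod p²)`. -/
theorem harmonic_shift (hp2 : p ≠ 2) {x₀ : ℕ} (hx₀ : x₀ < p) (X : ℕ) :
    Rat.padicValuation p ((p : ℚ) * hsum 1 (x₀ + X * p) - hsum 1 X - (p : ℚ) * hsum 1 x₀) ≤ exp (-2 : ℤ) := by
  have hp : p.Prime := Fact.out
  have hpv : Rat.padicValuation p (p : ℚ) = exp (-1 : ℤ) := Rat.padicValuation_self p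
  have hblocks := pow_mul_hsum_mul (p := p) 1 X
  rw [pow_one] at hblocks
  rw [show x₀ + X * p = X * p + x₀ by ring, hsum_add 1 (X * p) x₀, mul_add, hblocks,
    show hsum 1 X + (p : ℚ) * ∑ b ∈ range X, blockSigma p 1 b +
        (p : ℚ) * ∑ r ∈ Icc 1 x₀, 1 / (((X * p + r : ℕ) : ℚ)) ^ 1 - hsum 1 X - (p : ℚ) * hsum 1 x₀ =
      (p : ℚ) * (∑ b ∈ range X, blockSigma p 1 b +
        ∑ r ∈ Icc 1 x₀, (1 / (((X * p + r : ℕ) : ℚ)) - 1 / (r : ℚ))) by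
      simp only [hsum, pow_one, one_div, Finset.sum_sub_distrib]; ring, map_mul, hpv,
    show (-2 : ℤ) = -1 + -1 by norm_num, exp_add]
  refine mul_le_mul' le_rfl ((Valuation.map_add _ _ _).trans (max_le ?_ ?_))
  · exact Valuation.map_sum_le _ fun b _ => padicValuation_blockSigma_one_le hp2 b
  · refine Valuation.map_sum_le _ fun r hr => ?_
    have hr' := mem_Icc.1 hr
    exact padicValuation_inv_shift_sub_le hr'.1 (by omega)

end

end Summit.KontsevichZagierPeriods.Zeta5Search.BrickHarmonicShift
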